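import Summits.QuantumFields.YangMills.Theses.ThermalDescent
import Summits.QuantumFields.YangMills.Theorems.ThermalDescentCornerCov
import Summits.QuantumFields.YangMills.Theorems.ThermalDescentTorusDictionary

/-!
# `ThermalDescent.TransportIdentity` (stmt-QuantumFields-27342) — proved

The crux `TransportIdentity` (child of `HypercubeSeam`, route `ThermalDescent` rev 5): under the window hypotheses,
NT's reflected smeared two-point function on the periodic box of side `2L+1` is the `Fin`-torus reflection-positivity
quantity plus the electric corner discrepancy, `Q2(θv, v) = Qrp + Cov_P(D_v ∘ refl, B_v)`.  It is the kernel-checked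
composition `TransportIdentity_of` of the BC3 skeleton `Cruxes/NT/Lines/thermal_descent_transport_birth.lean` with both
registered stubs now theorems of the tree: the torus dictionary `Q2 = Cov_P(B_f, B_g)`
(`ThermalDescentTorusDictionary.stub_dictionary`) at `f = θv, g = v`, and the exact corner reflection inside covariances
(`ThermalDescentCornerCov.stub_cornerCov`) at `H = B_v`.  A finite-lattice identity; no summit, leg or spine crux
(in particular not NT) is proved here. [folklore]
-/

set_option autoImplicit false
set_option maxHeartbeats 800000

namespace Summit.QuantumFields.YangMills.Theorems.ThermalDescentTransportIdentity

open MeasureTheory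

/-- **`ThermalDescent.TransportIdentity`.** [folklore] -/
theorem thermalDescent_transportIdentity :
    Summit.QuantumFields.YangMills.Theses.ThermalDescent.TransportIdentity := by
  intro G _ _ _ _ hG r
  dsimp only
  intro β L s v δ₁ δ₂ hβ hL hs hδ₁ hsupp hsz
  have h1 := Summit.QuantumFields.YangMills.Theorems.ThermalDescentTorusDictionary.stub_dictionary G hG r β L s
    (Literature.MathematicalPhysics.QuantumLattice.thetaTest 4 v) v hL
  dsimp only at h1
  rw [h1]
  have h2 := Summit.QuantumFields.YangMills.Theorems.ThermalDescentCornerCov.stub_cornerCov G hG r β L s v δ₁ δ₂ hL hs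
    hδ₁ hsupp hsz
  dsimp only at h2
  refine h2 _ ?_
  letI : MeasurableSpace G := borel G
  haveI : BorelSpace G := ⟨rfl⟩
  exact continuous_finsetSum _ fun x _ => continuous_const.mul
    (Summit.QuantumFields.YangMills.Theorems.ThermalDescentTorusDictionary.continuous_aF r x)

end Summit.QuantumFields.YangMills.Theorems.ThermalDescentTransportIdentity
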